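import Mathlib
import Literature.NumberTheory.LFunctions.Zhang2022.Section13MeanSquareNB
import HarnessLib

/-!
# Zhang (2022) §13, towards (13.11): the `ψ`-free coefficient sequences of `B₁`, `H₂`, `B`, `N(·+β)`,
# `D_{T³}(·+w)` and of their products, as Dirichlet polynomials of length `≤ ⌊P⌋`, with their diagonal
# (log-mean-square) bounds — the inputs of the quadratic zero-sum bound of `Section13ZeroSumQuadratic`

Topic `Literature/NumberTheory/LFunctions/Zhang2022` (Landau–Siegel audit tree; verdict-neutral).
Y. Zhang, *Discrete mean estimates and the Landau–Siegel zero*, arXiv:2211.02515v1 (2022)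
[Zhang2022LandauSiegel] — **an unrefereed manuscript under adjudication**; nothing here asserts or denies
its Theorems 1–2 or (13.11). ZHANG-L WP14 (leaf `Skeleton.Eq1311Rel`, GAP row G-L3t6-3: "(2.34), Cauchy,
Proposition 7.1, Lemma 5.9, 6.1 and 3.3 … `𝔈 = o(𝔓)`" — not carried out in print).

The quadratic zero-sum bound `Typed.Section13.zeroSum_dirPoly_sq_le_of_prop22` (the (2.34)-conversion +
Lemma 5.9 + Lemma 3.3 (i) by ORTHOGONALITY, constant `1`, loss-free against `𝔓`) takes a Dirichlet polynomial
`F(s,ψ) = Σ_{1≤n≤⌊P⌋} c(n)ψ(n)n^{−s}` with `ψ`-FREE coefficients and returns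
`Q(F) ≤ C𝓛⁹𝔓·Σ_{n≤P}‖c(n)‖²(n^{−(1+2α)} + n^{−(1−2α)}) + K𝔓(c_max P)²e^{−𝓛¹⁰/8}`. Every factor of the
terms of `𝔈` (display after (13.10): `|L₁L₂/L′|(|L₃|t₀⁻¹ + |N₃|𝓛⁻¹²³ + E₁(ρ+β₃)) + |L₁N₃/L′|(|N₂|𝓛⁻¹²³
+ E₁(ρ+β₂))`, times `|B| = |B₁||B₂|`, `B₁ = H₁₄ + ι₂H₁₂`, `B₂ = H₂`, (12.2)) that is a Dirichlet
polynomial of length `≤ P` — `B₁`, `H₂`, `B`, `N(ρ+β_j)`, the `E₁`-integrand `D_{T³}(ρ+β_j+iv) =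
Σ_{n<T³}ψ(n)n^{−ρ−β_j−iv}` (Lemma 6.1), and the products `N·B_i`, `D_{T³}·B_i`, `N₂N₃` — is put here in
exactly that shape, ONCE:

* objects (ℂ-valued, `ψ`-free; no claim): `coefB1 χ`, `coefH2 χ`, `coefB χ` (`= b·χ`, (15.1)),
  `coefN D β` (`m^{−β}g*(T²/m)`), `coefD D w` (`n^{−w}·[n < ⌈T³⌉]`), and the restricted Dirichlet
  convolution `prodCoeff F G L M` of two coefficient sequences;
* identities `B1_eq_sum_Icc`, `H2_eq_sum_Icc`, `Bpoly_eq_sum_Icc`, `Nchar_shift_eq_sum_Icc`,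
  `dirPolyT3_eq_sum_Icc`, and for products `mul_twisted_eq_sum_Icc_prodCoeff` with the instances
  `Nchar_mul_B1_eq_sum_Icc`, `Nchar_mul_H2_eq_sum_Icc`, `dirPolyT3_mul_B1_eq_sum_Icc`,
  `dirPolyT3_mul_H2_eq_sum_Icc`, `Nchar_mul_Nchar_eq_sum_Icc` (all `= Σ_{n∈Icc 1 ⌊P⌋} c(n)ψ(n)n^{−s}`, `𝓛 ≥ 3`);
* pointwise majorants `‖c(n)‖ ≤ K·τ_j(n)` and crude sup bounds `‖c(n)‖ ≤ c_max` (for the negligible term);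
* **the diagonal bounds with EXPLICIT exponents** (`|e + 1| ≤ 4α`, i.e. both `e = −(1±2α)`):
  `Σ_{n≤⌊P⌋}‖c(n)‖²n^{e} ≤ C·𝓛^{k}` with `k = 9` for `B₁, H₂, N, D_{T³}` and `k = 36` for
  `B, N·B₁, N·H₂, D_{T³}·B₁, D_{T³}·H₂, N₂N₃` (`sum_sq_rpow_le_of_le_tau`: `n^{e} ≤ e^{8π}/n` on `n ≤ P²`,
  `Σ τ_j²/n ≤ majorantConst·(log)^{j²}`, `log(⌊P⌋+1) ≤ 2𝓛⁹`), uniformly in `v` for the `D_{T³}` families.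

Theorems + ℂ-valued object definitions only; no `Prop` definition, no new fact.

## References

* Y. Zhang, arXiv:2211.02515v1 (2022), §13 (13.3), (13.10)–(13.11) p. 75; §6 Lemma 6.1 p. 30; §12 (12.2);
  §15 (15.1)–(15.2); Lemma 3.3 p. 14. [cite: Zhang2022LandauSiegel, §13 (13.11) p.75]
-/

noncomputable section

open Complex Real ComplexConjugate

namespace Literature.NumberTheory.LFunctions.Zhang2022.Typed.Section13

open Skeleton MeanSquareMajorant

/-! ## Generic pieces -/

section Generic

variable {D : ℕ}

/-- `Σ_{1≤n<N} (Kτ_j(n))²·n^{e} ≤ e^{8π}·majorantConst(j²,2j)·K²·(log N)^{j²}` for `|e + 1| ≤ 4α` and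
`2 ≤ N ≤ ⌊P²⌋ + 1` (both exponents `e = −(1 ± 2α)` of the zero-sum bound).
[cite: Zhang2022LandauSiegel, §13 p.75; §7 (7.5) p.33] -/
theorem sum_tau_sq_rpow_le' (hL : 1 ≤ ell D) {e : ℝ} (he : |e + 1| ≤ 4 * alpha D)
    {N : ℕ} (hN2 : 2 ≤ N) (hN : N ≤ ⌊bigP D ^ 2⌋₊ + 1) (K : ℝ) (j : ℕ) :
    ∑ n ∈ Finset.Ico 1 N, (K * tau j n) ^ 2 * (n : ℝ) ^ e ≤
      Real.exp (8 * π) * majorantConst (j ^ 2) (2 * j) * K ^ 2 * Real.log N ^ (j ^ 2) := by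
  -- `e = -2 * s.re` with `s = -e/2`
  have h := sum_tau_sq_rpow_le (D := D) hL (s := ((-e / 2 : ℝ) : ℂ)) (by
    rw [Complex.ofReal_re]
    have : -e / 2 - 1 / 2 = -(e + 1) / 2 := by ring
    rw [this, abs_div, abs_neg, abs_two]; linarith) hN2 hN K j
  have he' : -2 * (((-e / 2 : ℝ) : ℂ)).re = e := by rw [Complex.ofReal_re]; ring
  rw [he'] at h
  exact h

/-- **The diagonal bound**: if `‖c(n)‖ ≤ K·τ_j(n)` for `n ≥ 1` then, for `|e + 1| ≤ 4α` and
`2 ≤ N ≤ ⌊P²⌋ + 1`, `Σ_{1≤n<N} ‖c(n)‖²n^{e} ≤ e^{8π}·majorantConst(j²,2j)·K²·(log N)^{j²}`.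
[cite: Zhang2022LandauSiegel, §13 p.75; §7 (7.5) p.33] -/
theorem sum_sq_rpow_le_of_le_tau (hL : 1 ≤ ell D) {e : ℝ} (he : |e + 1| ≤ 4 * alpha D)
    {N : ℕ} (hN2 : 2 ≤ N) (hN : N ≤ ⌊bigP D ^ 2⌋₊ + 1) {c : ℕ → ℂ} {K : ℝ} (j : ℕ)
    (hc : ∀ n, n ≠ 0 → ‖c n‖ ≤ K * tau j n) :
    ∑ n ∈ Finset.Ico 1 N, ‖c n‖ ^ 2 * (n : ℝ) ^ e ≤
      Real.exp (8 * π) * majorantConst (j ^ 2) (2 * j) * K ^ 2 * Real.log N ^ (j ^ 2) := by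
  refine le_trans (Finset.sum_le_sum fun n hn => ?_) (sum_tau_sq_rpow_le' hL he hN2 hN K j)
  rw [Finset.mem_Ico] at hn
  exact mul_le_mul_of_nonneg_right (pow_le_pow_left₀ (norm_nonneg _) (hc n (by omega)) 2)
    (Real.rpow_nonneg (Nat.cast_nonneg n) _)

/-- `τ_j(n) ≤ n^j` for `n ≥ 1` (crude; `τ_{j+1}(n) = Σ_{d∣n}τ_j(d) ≤ d(n)·n^j ≤ n^{j+1}`) — a weak form of
`τ_k(n) ≪ n^ε`. [cite: IwaniecKowalski2004, §1.6 (1.81)] -/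
theorem tau_le_pow (j : ℕ) {n : ℕ} (hn : n ≠ 0) : tau j n ≤ (n : ℝ) ^ j := by
  induction j generalizing n with
  | zero =>
    rw [tau_zero, ArithmeticFunction.one_apply, pow_zero]
    by_cases h : n = 1 <;> simp [h]
  | succ j ih =>
    rw [tau_succ_apply]
    have hn1 : (1 : ℝ) ≤ n := by exact_mod_cast Nat.one_le_iff_ne_zero.mpr hn
    calc ∑ d ∈ n.divisors, tau j d ≤ ∑ d ∈ n.divisors, (n : ℝ) ^ j := by
          refine Finset.sum_le_sum fun d hd => ?_
          have hd' := Nat.mem_divisors.mp hd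
          have hd0 : d ≠ 0 := Nat.pos_iff_ne_zero.mp (Nat.pos_of_mem_divisors hd)
          exact (ih hd0).trans (pow_le_pow_left₀ (Nat.cast_nonneg d)
            (by exact_mod_cast Nat.le_of_dvd (Nat.pos_of_ne_zero hn) hd'.1) j)
      _ = (n.divisors.card : ℝ) * (n : ℝ) ^ j := by rw [Finset.sum_const, nsmul_eq_mul]
      _ ≤ (n : ℝ) * (n : ℝ) ^ j := by
          gcongr; exact_mod_cast Nat.card_divisors_le_self n
      _ = (n : ℝ) ^ (j + 1) := by ring

/-- **The restricted Dirichlet convolution** of two coefficient sequences: `c(k) = Σ_{mn=k, 1≤m<L, 1≤n<M} F(m)G(n)`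
(the coefficient sequence of the product of two Dirichlet polynomials of lengths `L`, `M`).
[cite: Zhang2022LandauSiegel, §13 p.75; §16 p.33 (`b₁ = b ⋆ c`)] -/
def prodCoeff (F G : ℕ → ℂ) (L M : ℕ) (k : ℕ) : ℂ :=
  ∑ q ∈ (Finset.Ico 1 L ×ˢ Finset.Ico 1 M).filter (fun q => q.1 * q.2 = k), F q.1 * G q.2

/-- `‖prodCoeff F G L M k‖ ≤ K_F·K_G·τ_{j₁+j₂}(k)` for `k ≥ 1`. [cite: Zhang2022LandauSiegel, §13 p.75; §15 (15.2)] -/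
theorem norm_prodCoeff_le {F G : ℕ → ℂ} {KF KG : ℝ} {j₁ j₂ : ℕ} (hKF : 0 ≤ KF)
    (hF : ∀ m, m ≠ 0 → ‖F m‖ ≤ KF * tau j₁ m) (hG : ∀ n, n ≠ 0 → ‖G n‖ ≤ KG * tau j₂ n)
    (L M : ℕ) {k : ℕ} (hk : k ≠ 0) :
    ‖prodCoeff F G L M k‖ ≤ KF * KG * tau (j₁ + j₂) k :=
  norm_fiberSum_le hKF hF hG L M hk

/-- The restricted convolution vanishes beyond the product of the lengths (the product polynomial has
length `≤ (L−1)(M−1)`). [cite: Zhang2022LandauSiegel, §13 p.75; §16 p.33] -/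
theorem prodCoeff_eq_zero_of_lt {F G : ℕ → ℂ} {L M k : ℕ} (hk : (L - 1) * (M - 1) < k) :
    prodCoeff F G L M k = 0 := by
  unfold prodCoeff
  refine Finset.sum_eq_zero fun q hq => ?_
  exfalso
  rw [Finset.mem_filter, Finset.mem_product, Finset.mem_Ico, Finset.mem_Ico] at hq
  have : q.1 * q.2 ≤ (L - 1) * (M - 1) := Nat.mul_le_mul (by omega) (by omega)
  omega

/-- A crude sup bound: `‖prodCoeff F G L M k‖ ≤ K_F·K_G·((L−1)(M−1))^{j₁+j₂}` for all `k`
(`τ_j(k) ≤ k^j` on the support `k ≤ (L−1)(M−1)`; the `c_max` of the negligible term of the zero-sum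
bound). [cite: Zhang2022LandauSiegel, §13 p.75] -/
theorem norm_prodCoeff_le_sup {F G : ℕ → ℂ} {KF KG : ℝ} {j₁ j₂ : ℕ} (hKF : 0 ≤ KF) (hKG : 0 ≤ KG)
    (hF : ∀ m, m ≠ 0 → ‖F m‖ ≤ KF * tau j₁ m) (hG : ∀ n, n ≠ 0 → ‖G n‖ ≤ KG * tau j₂ n)
    (L M k : ℕ) :
    ‖prodCoeff F G L M k‖ ≤ KF * KG * (((L - 1) * (M - 1) : ℕ) : ℝ) ^ (j₁ + j₂) := by
  rcases Nat.eq_zero_or_pos k with rfl | hk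
  · have : prodCoeff F G L M 0 = 0 := by
      unfold prodCoeff
      refine Finset.sum_eq_zero fun q hq => ?_
      exfalso
      rw [Finset.mem_filter, Finset.mem_product, Finset.mem_Ico, Finset.mem_Ico] at hq
      have := Nat.mul_ne_zero (show q.1 ≠ 0 by omega) (show q.2 ≠ 0 by omega)
      exact this hq.2
    rw [this, norm_zero]; positivity
  by_cases hkL : (L - 1) * (M - 1) < k
  · rw [prodCoeff_eq_zero_of_lt hkL, norm_zero]; positivity
  · push Not at hkL
    calc ‖prodCoeff F G L M k‖ ≤ KF * KG * tau (j₁ + j₂) k := norm_prodCoeff_le hKF hF hG L M hk.ne'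
      _ ≤ KF * KG * (k : ℝ) ^ (j₁ + j₂) :=
          mul_le_mul_of_nonneg_left (tau_le_pow _ hk.ne') (mul_nonneg hKF hKG)
      _ ≤ KF * KG * (((L - 1) * (M - 1) : ℕ) : ℝ) ^ (j₁ + j₂) := by
          have hkL' : (k : ℝ) ≤ (((L - 1) * (M - 1) : ℕ) : ℝ) := by exact_mod_cast hkL
          exact mul_le_mul_of_nonneg_left (pow_le_pow_left₀ (Nat.cast_nonneg k) hkL' _)
            (mul_nonneg hKF hKG)

variable (x : Chr D)

/-- **Product of two `ψ`-twisted polynomials = one `ψ`-twisted polynomial over `1 ≤ k ≤ K`** with the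
coefficients `prodCoeff` (regrouping along `k = mn`), whenever `(L−1)(M−1) ≤ K`.
[cite: Zhang2022LandauSiegel, §13 p.75; §16 p.33] -/
theorem mul_twisted_eq_sum_Icc_prodCoeff (F G : ℕ → ℂ) {L M K : ℕ} (hK : (L - 1) * (M - 1) ≤ K)
    (s : ℂ) :
    (∑ m ∈ Finset.Ico 1 L, F m * x.ψ (m : ZMod x.p) * (m : ℂ) ^ (-s)) *
        (∑ n ∈ Finset.Ico 1 M, G n * x.ψ (n : ZMod x.p) * (n : ℂ) ^ (-s)) =
      ∑ k ∈ Finset.Icc 1 K, prodCoeff F G L M k * x.ψ (k : ZMod x.p) * (k : ℂ) ^ (-s) :=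
  mul_twisted_eq_sum_fiber x F G hK s

/-- Extending a `ψ`-twisted sum over `1 ≤ n < N` to `1 ≤ n ≤ K` (`N ≤ K + 1`) when the coefficients
vanish from `N` on (all the manuscript's polynomials are written over `1 ≤ n ≤ P` this way).
[cite: Zhang2022LandauSiegel, §13 p.75; Lemma 3.3 p.14] -/
theorem sum_Ico_eq_sum_Icc_of_vanish (a : ℕ → ℂ) {N K : ℕ} (hNK : N ≤ K + 1)
    (ha : ∀ n, N ≤ n → a n = 0) (s : ℂ) :
    ∑ n ∈ Finset.Ico 1 N, a n * x.ψ (n : ZMod x.p) * (n : ℂ) ^ (-s) =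
      ∑ n ∈ Finset.Icc 1 K, a n * x.ψ (n : ZMod x.p) * (n : ℂ) ^ (-s) := by
  apply Finset.sum_subset
  · intro n hn
    rw [Finset.mem_Ico] at hn; rw [Finset.mem_Icc]; omega
  · intro n hn hn'
    rw [Finset.mem_Icc] at hn
    rw [Finset.mem_Ico, not_and_or, not_le, not_lt] at hn'
    rcases hn' with h0 | hN
    · omega
    · rw [ha n hN]; simp

end Generic

/-! ## Sizes (`𝓛 ≥ 3`) -/

section Sizes

variable {D : ℕ}

/-- For `𝓛 ≥ 3`: `2T²·P₁ + 1 ≤ P`, `T³·P₁ + 1 ≤ P`, `4T⁴ + 1 ≤ P`, `2T² + 1 ≤ P`, `T³ + 1 ≤ P`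
(`T = e^{𝓛^{1.1}}`, `P₁ = P^{0.504}`, `P = e^{𝓛⁹}`; all from `5𝓛^{1.1} + 2 ≤ 0.496𝓛⁹`).
[cite: Zhang2022LandauSiegel, §2 (2.6), (2.21); §6 Lemma 6.1] -/
theorem lengths_le_bigP (hL : 3 ≤ ell D) :
    2 * bigT D ^ 2 * Skeleton.P1 D + 1 ≤ bigP D ∧ bigT D ^ 3 * Skeleton.P1 D + 1 ≤ bigP D ∧
      4 * bigT D ^ 4 + 1 ≤ bigP D ∧ 2 * bigT D ^ 2 + 1 ≤ bigP D ∧ bigT D ^ 3 + 1 ≤ bigP D := by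
  have hL1 : 1 ≤ ell D := by linarith
  have hL0 : 0 < ell D := by linarith
  -- `𝓛^{1.1} ≤ 𝓛²`
  have h11 : ell D ^ (1.1 : ℝ) ≤ ell D ^ 2 := by
    calc ell D ^ (1.1 : ℝ) ≤ ell D ^ ((2 : ℕ) : ℝ) := Real.rpow_le_rpow_of_exponent_le hL1 (by norm_num)
      _ = ell D ^ 2 := Real.rpow_natCast _ 2
  have h11pos : 0 ≤ ell D ^ (1.1 : ℝ) := Real.rpow_nonneg hL0.le _
  -- the master inequality `5𝓛² + 3 ≤ 0.496𝓛⁹`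
  have hmaster : 5 * ell D ^ 2 + 3 ≤ 0.496 * ell D ^ 9 := by
    have h3 : (3 : ℝ) ^ 7 ≤ ell D ^ 7 := pow_le_pow_left₀ (by norm_num) hL 7
    have e : ell D ^ 9 = ell D ^ 7 * ell D ^ 2 := by ring
    nlinarith [pow_nonneg hL0.le 2, pow_nonneg hL0.le 7]
  have hT : bigT D = Real.exp (ell D ^ (1.1 : ℝ)) := by rw [bigT]
  have hP : bigP D = Real.exp (ell D ^ 9) := by rw [bigP]
  have hP1 : Skeleton.P1 D = Real.exp (0.504 * ell D ^ 9) := by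
    rw [Skeleton.P1, bigP, ← Real.exp_mul]; ring_nf
  have hTpow : ∀ k : ℕ, bigT D ^ k = Real.exp (k * ell D ^ (1.1 : ℝ)) := fun k => by
    rw [hT, ← Real.exp_nat_mul]
  -- generic step: `exp(a) + 1 ≤ exp(ell D⁹)` when `0 ≤ a` and `a + 1 ≤ ell D⁹`
  have key : ∀ a : ℝ, 0 ≤ a → a + 1 ≤ ell D ^ 9 → Real.exp a + 1 ≤ Real.exp (ell D ^ 9) := by
    intro a ha0 ha
    have h1 : 1 ≤ Real.exp a := Real.one_le_exp ha0
    have h2 : (2 : ℝ) ≤ Real.exp 1 := by linarith [Real.add_one_le_exp (1 : ℝ)]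
    calc Real.exp a + 1 ≤ 2 * Real.exp a := by linarith
      _ ≤ Real.exp 1 * Real.exp a := mul_le_mul_of_nonneg_right h2 (Real.exp_nonneg a)
      _ = Real.exp (a + 1) := by rw [← Real.exp_add]; ring_nf
      _ ≤ Real.exp (ell D ^ 9) := Real.exp_le_exp.mpr ha
  have h2e : (2 : ℝ) ≤ Real.exp 1 := by linarith [Real.add_one_le_exp (1 : ℝ)]
  have h4e : (4 : ℝ) ≤ Real.exp 2 := by
    have := Real.add_one_le_exp (1 : ℝ)
    have e2 : Real.exp 2 = Real.exp 1 * Real.exp 1 := by rw [← Real.exp_add]; norm_num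
    nlinarith [Real.exp_pos (1 : ℝ)]
  have hT2 : bigT D ^ 2 = Real.exp (2 * ell D ^ (1.1 : ℝ)) := by rw [hTpow 2]; norm_num
  have hT3 : bigT D ^ 3 = Real.exp (3 * ell D ^ (1.1 : ℝ)) := by rw [hTpow 3]; norm_num
  have hT4 : bigT D ^ 4 = Real.exp (4 * ell D ^ (1.1 : ℝ)) := by rw [hTpow 4]; norm_num
  have hP10 : 0 ≤ Skeleton.P1 D := by rw [hP1]; exact Real.exp_nonneg _
  refine ⟨?_, ?_, ?_, ?_, ?_⟩
  · -- `2T²P₁ ≤ exp(1 + 2ell D^{1.1} + 0.504ell D⁹)`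
    have hle : 2 * bigT D ^ 2 * Skeleton.P1 D ≤ Real.exp (1 + 2 * ell D ^ (1.1 : ℝ) + 0.504 * ell D ^ 9) := by
      rw [hT2, hP1, Real.exp_add, Real.exp_add]
      have := Real.exp_nonneg (2 * ell D ^ (1.1 : ℝ))
      have := Real.exp_nonneg (0.504 * ell D ^ 9)
      nlinarith [mul_nonneg (Real.exp_nonneg (2 * ell D ^ (1.1 : ℝ))) (Real.exp_nonneg (0.504 * ell D ^ 9))]
    have := key (1 + 2 * ell D ^ (1.1 : ℝ) + 0.504 * ell D ^ 9) (by positivity) (by nlinarith)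
    rw [hP]; linarith
  · have hle : bigT D ^ 3 * Skeleton.P1 D = Real.exp (3 * ell D ^ (1.1 : ℝ) + 0.504 * ell D ^ 9) := by
      rw [hT3, hP1, ← Real.exp_add]
    have := key (3 * ell D ^ (1.1 : ℝ) + 0.504 * ell D ^ 9) (by positivity) (by nlinarith)
    rw [hP, hle]; linarith
  · have hle : 4 * bigT D ^ 4 ≤ Real.exp (2 + 4 * ell D ^ (1.1 : ℝ)) := by
      rw [hT4, Real.exp_add]
      exact mul_le_mul_of_nonneg_right h4e (Real.exp_nonneg _)
    have := key (2 + 4 * ell D ^ (1.1 : ℝ)) (by positivity) (by nlinarith)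
    rw [hP]; linarith
  · have hle : 2 * bigT D ^ 2 ≤ Real.exp (1 + 2 * ell D ^ (1.1 : ℝ)) := by
      rw [hT2, Real.exp_add]
      exact mul_le_mul_of_nonneg_right h2e (Real.exp_nonneg _)
    have := key (1 + 2 * ell D ^ (1.1 : ℝ)) (by positivity) (by nlinarith)
    rw [hP]; linarith
  · have := key (3 * ell D ^ (1.1 : ℝ)) (by positivity) (by nlinarith)
    rw [hP, hT3]; linarith

/-- Integer forms of the length bookkeeping (`𝓛 ≥ 3`): `(⌈2T²⌉−1)(⌈P₁⌉−1) ≤ ⌊P⌋`,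
`(⌈T³⌉−1)(⌈P₁⌉−1) ≤ ⌊P⌋`, `(⌈2T²⌉−1)(⌈2T²⌉−1) ≤ ⌊P⌋`, `⌈2T²⌉ ≤ ⌊P⌋ + 1`, `⌈T³⌉ ≤ ⌊P⌋ + 1`,
`⌈P₁⌉ ≤ ⌊P⌋ + 1`, `⌊PT⁻²⌋ + 1 ≤ ⌊P⌋ + 1`, `2 ≤ ⌊P⌋ + 1 ≤ ⌊P²⌋ + 1`, `log(⌊P⌋+1) ≤ 2𝓛⁹`.
[cite: Zhang2022LandauSiegel, §2 (2.6), (2.21); §6 Lemma 6.1; §7 (7.2)] -/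
theorem intLengths_of_three_le (hL : 3 ≤ ell D) :
    (⌈2 * bigT D ^ 2⌉₊ - 1) * (⌈Skeleton.P1 D⌉₊ - 1) ≤ ⌊bigP D⌋₊ ∧
    (⌈bigT D ^ 3⌉₊ - 1) * (⌈Skeleton.P1 D⌉₊ - 1) ≤ ⌊bigP D⌋₊ ∧
    (⌈2 * bigT D ^ 2⌉₊ - 1) * (⌈2 * bigT D ^ 2⌉₊ - 1) ≤ ⌊bigP D⌋₊ ∧
    ⌈2 * bigT D ^ 2⌉₊ ≤ ⌊bigP D⌋₊ + 1 ∧ ⌈bigT D ^ 3⌉₊ ≤ ⌊bigP D⌋₊ + 1 ∧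
    ⌈Skeleton.P1 D⌉₊ ≤ ⌊bigP D⌋₊ + 1 ∧ ⌊bigP D / bigT D ^ 2⌋₊ + 1 ≤ ⌊bigP D⌋₊ + 1 ∧
    (2 ≤ ⌊bigP D⌋₊ + 1 ∧ ⌊bigP D⌋₊ + 1 ≤ ⌊bigP D ^ 2⌋₊ + 1) ∧
    Real.log ((⌊bigP D⌋₊ + 1 : ℕ) : ℝ) ≤ 2 * ell D ^ 9 := by
  obtain ⟨h1, h2, h3, h4, h5⟩ := lengths_le_bigP hL
  obtain ⟨hP1P, hPTP, hPT1, hPP2⟩ := sizes_of_three_le hL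
  have hL0 : 0 < ell D := by linarith
  have hP : 0 < bigP D := Real.exp_pos _
  have hT0 : 0 < bigT D := Real.exp_pos _
  have hP10 : 0 ≤ Skeleton.P1 D := Real.rpow_nonneg hP.le _
  -- real values of the truncated lengths
  have cA : ((⌈2 * bigT D ^ 2⌉₊ - 1 : ℕ) : ℝ) ≤ 2 * bigT D ^ 2 := by
    have hc : 1 ≤ ⌈2 * bigT D ^ 2⌉₊ := Nat.one_le_iff_ne_zero.mpr (Nat.ceil_pos.mpr (by positivity)).ne'
    rw [Nat.cast_sub hc]; push_cast
    linarith [(Nat.ceil_lt_add_one (show 0 ≤ 2 * bigT D ^ 2 by positivity)).le]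
  have cT3 : ((⌈bigT D ^ 3⌉₊ - 1 : ℕ) : ℝ) ≤ bigT D ^ 3 := by
    have hc : 1 ≤ ⌈bigT D ^ 3⌉₊ := Nat.one_le_iff_ne_zero.mpr (Nat.ceil_pos.mpr (by positivity)).ne'
    rw [Nat.cast_sub hc]; push_cast
    linarith [(Nat.ceil_lt_add_one (show 0 ≤ bigT D ^ 3 by positivity)).le]
  have cB : ((⌈Skeleton.P1 D⌉₊ - 1 : ℕ) : ℝ) ≤ Skeleton.P1 D := by
    have hc : 1 ≤ ⌈Skeleton.P1 D⌉₊ := by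
      have : 2 ≤ ⌈Skeleton.P1 D⌉₊ := (truncations_of_three_le hL).1.1
      omega
    rw [Nat.cast_sub hc]; push_cast; linarith [(Nat.ceil_lt_add_one hP10).le]
  have floorP : ∀ {y : ℝ}, y ≤ bigP D → ∀ {n : ℕ}, (n : ℝ) ≤ y → n ≤ ⌊bigP D⌋₊ :=
    fun hy _ hn => Nat.le_floor (hn.trans hy)
  refine ⟨?_, ?_, ?_, ?_, ?_, ?_, ?_, ⟨?_, ?_⟩, ?_⟩
  · refine floorP (y := 2 * bigT D ^ 2 * Skeleton.P1 D) (by linarith) ?_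
    push_cast
    calc _ ≤ (2 * bigT D ^ 2) * Skeleton.P1 D := mul_le_mul cA cB (Nat.cast_nonneg _) (by positivity)
      _ = 2 * bigT D ^ 2 * Skeleton.P1 D := by ring
  · refine floorP (y := bigT D ^ 3 * Skeleton.P1 D) (by linarith) ?_
    push_cast
    exact mul_le_mul cT3 cB (Nat.cast_nonneg _) (by positivity)
  · refine floorP (y := 4 * bigT D ^ 4) (by linarith) ?_
    push_cast
    calc _ ≤ (2 * bigT D ^ 2) * (2 * bigT D ^ 2) := mul_le_mul cA cA (Nat.cast_nonneg _) (by positivity)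
      _ = 4 * bigT D ^ 4 := by ring
  · have : ⌈2 * bigT D ^ 2⌉₊ ≤ ⌊bigP D⌋₊ :=
      floorP (y := 2 * bigT D ^ 2 + 1) (by linarith)
        (Nat.ceil_lt_add_one (show 0 ≤ 2 * bigT D ^ 2 by positivity)).le
    omega
  · have : ⌈bigT D ^ 3⌉₊ ≤ ⌊bigP D⌋₊ :=
      floorP (y := bigT D ^ 3 + 1) (by linarith)
        (Nat.ceil_lt_add_one (show 0 ≤ bigT D ^ 3 by positivity)).le
    omega
  · have : ⌈Skeleton.P1 D⌉₊ ≤ ⌊bigP D⌋₊ :=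
      floorP (y := Skeleton.P1 D + 1) (by linarith) (Nat.ceil_lt_add_one hP10).le
    omega
  · have : ⌊bigP D / bigT D ^ 2⌋₊ ≤ ⌊bigP D⌋₊ := Nat.floor_mono (by linarith)
    omega
  · have : 1 ≤ ⌊bigP D⌋₊ := Nat.le_floor (by exact_mod_cast (show (1:ℝ) ≤ bigP D by linarith))
    omega
  · have : ⌊bigP D⌋₊ ≤ ⌊bigP D ^ 2⌋₊ := Nat.floor_mono hPP2
    omega
  · have hfl : ((⌊bigP D⌋₊ + 1 : ℕ) : ℝ) ≤ Real.exp (2 * ell D ^ 9) := by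
      push_cast
      have h1 : (⌊bigP D⌋₊ : ℝ) ≤ bigP D := Nat.floor_le hP.le
      have e : Real.exp (2 * ell D ^ 9) = bigP D * bigP D := by rw [bigP, ← Real.exp_add]; ring_nf
      have hP2 : 2 ≤ bigP D := by linarith
      rw [e]; nlinarith
    calc Real.log ((⌊bigP D⌋₊ + 1 : ℕ) : ℝ) ≤ Real.log (Real.exp (2 * ell D ^ 9)) :=
          Real.log_le_log (by positivity) hfl
      _ = 2 * ell D ^ 9 := Real.log_exp _

end Sizes


/-! ## The diagonal bound in the shape consumed by `zeroSum_dirPoly_sq_le_of_prop22` -/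

section Diagonal

variable {D : ℕ}

/-- **Diagonal bound, generic**: for `𝓛 ≥ 3` and `‖c(n)‖ ≤ K·τ_j(n)` (`n ≥ 1`),
`Σ_{1≤n≤⌊P⌋} ‖c(n)‖²·(n^{−(1+2α)} + n^{−(1−2α)}) ≤ 2·e^{8π}·majorantConst(j²,2j)·K²·(2𝓛⁹)^{j²}`.
[cite: Zhang2022LandauSiegel, §13 (13.11) p.75; §7 (7.5)] -/
theorem diag_le_of_le_tau (hL : 3 ≤ ell D) {c : ℕ → ℂ} {K : ℝ} (j : ℕ)
    (hc : ∀ n, n ≠ 0 → ‖c n‖ ≤ K * tau j n) :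
    ∑ n ∈ Finset.Icc 1 ⌊bigP D⌋₊,
        ‖c n‖ ^ 2 * ((n : ℝ) ^ (-(1 + 2 * alpha D)) + (n : ℝ) ^ (-(1 - 2 * alpha D))) ≤
      2 * Real.exp (8 * π) * majorantConst (j ^ 2) (2 * j) * K ^ 2 * (2 * ell D ^ 9) ^ (j ^ 2) := by
  have hL1 : 1 ≤ ell D := by linarith
  have hL0 : 0 < ell D := by linarith
  obtain ⟨-, -, -, -, -, -, -, ⟨hN2, hN⟩, hlog⟩ := intLengths_of_three_le hL
  have hα : 0 < alpha D := by rw [alpha, bigP, Real.log_exp]; positivity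
  have hIcc : Finset.Icc 1 ⌊bigP D⌋₊ = Finset.Ico 1 (⌊bigP D⌋₊ + 1) := by
    ext n; simp only [Finset.mem_Icc, Finset.mem_Ico]; omega
  have he₁ : |-(1 + 2 * alpha D) + 1| ≤ 4 * alpha D := by
    rw [show -(1 + 2 * alpha D) + 1 = -(2 * alpha D) by ring, abs_neg, abs_of_pos (by positivity)]
    linarith
  have he₂ : |-(1 - 2 * alpha D) + 1| ≤ 4 * alpha D := by
    rw [show -(1 - 2 * alpha D) + 1 = 2 * alpha D by ring, abs_of_pos (by positivity)]; linarith
  have h1 := sum_sq_rpow_le_of_le_tau hL1 he₁ hN2 hN j hc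
  have h2 := sum_sq_rpow_le_of_le_tau hL1 he₂ hN2 hN j hc
  have hlog0 : 0 ≤ Real.log ((⌊bigP D⌋₊ + 1 : ℕ) : ℝ) := Real.log_natCast_nonneg _
  have hpow : Real.log ((⌊bigP D⌋₊ + 1 : ℕ) : ℝ) ^ (j ^ 2) ≤ (2 * ell D ^ 9) ^ (j ^ 2) :=
    pow_le_pow_left₀ hlog0 hlog _
  have hK : 0 ≤ Real.exp (8 * π) * majorantConst (j ^ 2) (2 * j) * K ^ 2 :=
    mul_nonneg (mul_nonneg (Real.exp_nonneg _) (majorantConst_pos _ _).le) (sq_nonneg _)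
  rw [hIcc]
  simp_rw [mul_add]
  rw [Finset.sum_add_distrib]
  calc _ ≤ Real.exp (8 * π) * majorantConst (j ^ 2) (2 * j) * K ^ 2 *
            Real.log ((⌊bigP D⌋₊ + 1 : ℕ) : ℝ) ^ (j ^ 2) +
          Real.exp (8 * π) * majorantConst (j ^ 2) (2 * j) * K ^ 2 *
            Real.log ((⌊bigP D⌋₊ + 1 : ℕ) : ℝ) ^ (j ^ 2) := add_le_add h1 h2
    _ ≤ Real.exp (8 * π) * majorantConst (j ^ 2) (2 * j) * K ^ 2 * (2 * ell D ^ 9) ^ (j ^ 2) +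
          Real.exp (8 * π) * majorantConst (j ^ 2) (2 * j) * K ^ 2 * (2 * ell D ^ 9) ^ (j ^ 2) :=
        add_le_add (mul_le_mul_of_nonneg_left hpow hK) (mul_le_mul_of_nonneg_left hpow hK)
    _ = _ := by ring

end Diagonal

/-! ## The coefficient sequences of `B₁`, `H₂`, `B`, `N(·+β)`, `D_{T³}(·+w)` -/

section Coefficients

variable {D : ℕ} (χ : DirichletCharacter ℂ D) (x : Chr D)

/-- **Coefficients of `B₁ = H₁₄ + ι₂H₁₂` as a `ψ`-twisted polynomial**: `(ϰ₁(n)·[n < P^{1/2}] + ι₂ϰ₂(n))·χ(n)`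
((12.1), (2.26); the real character `χ` rides in the coefficient). [cite: Zhang2022LandauSiegel, §12 (12.1)–(12.2) p.67] -/
def coefB1 (n : ℕ) : ℂ :=
  ((if (n : ℝ) < bigP D ^ (1 / 2 : ℝ) then vk1 D n else 0) + iota2 * vk2 D n) * χ (n : ZMod D)

/-- **Coefficients of `B₂ = H₂ = ῑ₃H₁₃ + ῑ₄H₁₂`**: `(ῑ₃ϰ₃(n) + ῑ₄ϰ₂(n))·χ(n)` ((2.27)).
[cite: Zhang2022LandauSiegel, §2 (2.27) p.6; §12 (12.2) p.67] -/
def coefH2 (n : ℕ) : ℂ := (conj iota3 * vk3 D n + conj iota4 * vk2 D n) * χ (n : ZMod D)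

/-- **Coefficients of `B = B₁B₂`**: `b(n)χ(n)` ((15.1): `B(s,ψ) = Σ b(n)ψχ(n)n^{−s}`).
[cite: Zhang2022LandauSiegel, §15 (15.1) p.79] -/
def coefB (n : ℕ) : ℂ := bcoef D n * χ (n : ZMod D)

/-- **Coefficients of `N(s+β,ψ)`** (Lemma 6.1): `m^{−β}·g*(T²/m)` (vanishes for `m ≥ 2T²`).
[cite: Zhang2022LandauSiegel, §6 Lemma 6.1 p.30] -/
def coefN (D : ℕ) (β : ℂ) (m : ℕ) : ℂ := (m : ℂ) ^ (-β) * (gstar D (bigT D ^ 2 / m) : ℂ)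

/-- **Coefficients of the `E₁`-integrand `D_{T³}(s+w,ψ) = Σ_{n<T³}ψ(n)n^{−s−w}`** (Lemma 6.1, `w = β_j + iv`):
`n^{−w}·[n < ⌈T³⌉]`. [cite: Zhang2022LandauSiegel, §6 Lemma 6.1 p.30; §13 (13.3)] -/
def coefD (D : ℕ) (w : ℂ) (n : ℕ) : ℂ := if n < ⌈bigT D ^ 3⌉₊ then (n : ℂ) ^ (-w) else 0

omit x in
/-- `‖coefB1 χ n‖ ≤ (1 + |ι₂|)·τ₁(n)` for `n ≥ 1`, and `≤ 1 + |ι₂|` always (`𝓛 ≥ 2`).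
[cite: Zhang2022LandauSiegel, §15 (15.2) p.79] -/
theorem norm_coefB1_le' (hD : 2 ≤ Real.log D) (n : ℕ) :
    ‖coefB1 χ n‖ ≤ 1 + ‖iota2‖ ∧ (n ≠ 0 → ‖coefB1 χ n‖ ≤ (1 + ‖iota2‖) * tau 1 n) := by
  have h : ‖coefB1 χ n‖ ≤ 1 + ‖iota2‖ := by
    rw [coefB1, norm_mul]
    exact (mul_le_of_le_one_right (norm_nonneg _) (DirichletCharacter.norm_le_one χ _)).trans
      (norm_coefB1_le hD n)
  exact ⟨h, fun hn => by rw [tau_one_apply hn, mul_one]; exact h⟩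

omit x in
/-- `‖coefH2 χ n‖ ≤ |ι₃| + |ι₄|` (and the `τ₁`-form). [cite: Zhang2022LandauSiegel, §15 (15.2) p.79] -/
theorem norm_coefH2_le' (hD : 2 ≤ Real.log D) (n : ℕ) :
    ‖coefH2 χ n‖ ≤ ‖iota3‖ + ‖iota4‖ ∧ (n ≠ 0 → ‖coefH2 χ n‖ ≤ (‖iota3‖ + ‖iota4‖) * tau 1 n) := by
  have h : ‖coefH2 χ n‖ ≤ ‖iota3‖ + ‖iota4‖ := by
    rw [coefH2, norm_mul]
    exact (mul_le_of_le_one_right (norm_nonneg _) (DirichletCharacter.norm_le_one χ _)).trans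
      (norm_coefH2_le hD n)
  exact ⟨h, fun hn => by rw [tau_one_apply hn, mul_one]; exact h⟩

omit x in
/-- `‖coefB χ n‖ ≤ (1+|ι₂|)(|ι₃|+|ι₄|)·τ₂(n)` ((15.2)), and the crude sup `≤ (1+|ι₂|)(|ι₃|+|ι₄|)·n²`.
[cite: Zhang2022LandauSiegel, §15 (15.2) p.79] -/
theorem norm_coefB_le (hD : 2 ≤ Real.log D) (n : ℕ) :
    ‖coefB χ n‖ ≤ (1 + ‖iota2‖) * (‖iota3‖ + ‖iota4‖) * tau 2 n ∧
      ‖coefB χ n‖ ≤ (1 + ‖iota2‖) * (‖iota3‖ + ‖iota4‖) * (n : ℝ) ^ 2 := by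
  have h : ‖coefB χ n‖ ≤ (1 + ‖iota2‖) * (‖iota3‖ + ‖iota4‖) * tau 2 n := by
    rw [coefB, norm_mul]
    exact (mul_le_of_le_one_right (norm_nonneg _) (DirichletCharacter.norm_le_one χ _)).trans
      (norm_bcoef_le hD n)
  refine ⟨h, ?_⟩
  rcases Nat.eq_zero_or_pos n with rfl | hn
  · have : coefB χ 0 = 0 := by
      rw [coefB, bcoef, Nat.divisorsAntidiagonal_zero, Finset.sum_empty, zero_mul]
    rw [this, norm_zero]; positivity
  · exact h.trans (mul_le_mul_of_nonneg_left (tau_le_pow 2 hn.ne') (by positivity))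

omit χ x in
/-- `‖coefN D β m‖ ≤ 1` for `Re β = 0` (and the `τ₁`-form); `𝓛 > 0`.
[cite: Zhang2022LandauSiegel, §6 Lemma 6.1 p.30] -/
theorem norm_coefN_le (hL : 0 < ell D) {β : ℂ} (hβ : β.re = 0) (m : ℕ) :
    ‖coefN D β m‖ ≤ 1 ∧ (m ≠ 0 → ‖coefN D β m‖ ≤ 1 * tau 1 m) := by
  have h : ‖coefN D β m‖ ≤ 1 := by
    rcases Nat.eq_zero_or_pos m with rfl | hm
    · rw [coefN, norm_mul]
      have h1 : ‖((0 : ℕ) : ℂ) ^ (-β)‖ ≤ 1 := by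
        rw [Nat.cast_zero]
        by_cases hb : -β = 0
        · rw [hb, Complex.cpow_zero, norm_one]
        · rw [Complex.zero_cpow hb, norm_zero]; exact zero_le_one
      exact (mul_le_mul h1 (norm_gstar_le_one hL _) (norm_nonneg _) zero_le_one).trans (by norm_num)
    · have := norm_Nchar_coeff_le (D := D) hL hβ m hm.ne'
      rw [tau_one_apply hm.ne', mul_one] at this
      exact this
  exact ⟨h, fun hm => by rw [tau_one_apply hm, mul_one]; exact h⟩

omit χ x in
/-- `‖coefD D w n‖ ≤ 1` for `Re w = 0` (and the `τ₁`-form). [cite: Zhang2022LandauSiegel, §6 Lemma 6.1 p.30] -/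
theorem norm_coefD_le {w : ℂ} (hw : w.re = 0) (n : ℕ) :
    ‖coefD D w n‖ ≤ 1 ∧ (n ≠ 0 → ‖coefD D w n‖ ≤ 1 * tau 1 n) := by
  have h : ‖coefD D w n‖ ≤ 1 := by
    rw [coefD]
    split_ifs
    · rcases Nat.eq_zero_or_pos n with rfl | hn
      · rw [Nat.cast_zero]
        by_cases hb : -w = 0
        · rw [hb, Complex.cpow_zero, norm_one]
        · rw [Complex.zero_cpow hb, norm_zero]; exact zero_le_one
      · rw [Complex.norm_natCast_cpow_of_pos hn, Complex.neg_re, hw, neg_zero, Real.rpow_zero]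
    · rw [norm_zero]; exact zero_le_one
  exact ⟨h, fun hn => by rw [tau_one_apply hn, mul_one]; exact h⟩

/-! ### The five polynomials over `1 ≤ n ≤ ⌊P⌋` -/

omit χ x in
/-- `P^{1/2} ≤ P₁ = P^{0.504}`. [cite: Zhang2022LandauSiegel, §2 (2.21)] -/
theorem sqrt_bigP_le_P1 : bigP D ^ (1 / 2 : ℝ) ≤ Skeleton.P1 D := by
  rw [Skeleton.P1]
  exact Real.rpow_le_rpow_of_exponent_le
    (Real.one_le_exp (pow_nonneg (Real.log_natCast_nonneg D) _)) (by norm_num)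

omit x in
/-- `coefB1 χ n = 0` for `n ≥ ⌈P₁⌉`. [cite: Zhang2022LandauSiegel, §12 (12.1); §2 (2.21)] -/
theorem coefB1_eq_zero {n : ℕ} (hn : ⌈Skeleton.P1 D⌉₊ ≤ n) : coefB1 χ n = 0 := by
  have hP1n : Skeleton.P1 D ≤ n := le_trans (Nat.le_ceil _) (by exact_mod_cast hn)
  have h1 : ¬ (n : ℝ) < bigP D ^ (1 / 2 : ℝ) := not_lt.mpr (sqrt_bigP_le_P1.trans hP1n)
  rw [coefB1, if_neg h1, vk2_eq_zero ((P2_le_P1 D).trans hP1n)]; simp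

omit x in
/-- `coefH2 χ n = 0` for `n ≥ ⌈P₁⌉`. [cite: Zhang2022LandauSiegel, §2 (2.27), (2.21)] -/
theorem coefH2_eq_zero {n : ℕ} (hn : ⌈Skeleton.P1 D⌉₊ ≤ n) : coefH2 χ n = 0 := by
  have hP1n : Skeleton.P1 D ≤ n := le_trans (Nat.le_ceil _) (by exact_mod_cast hn)
  rw [coefH2, vk2_eq_zero ((P2_le_P1 D).trans hP1n), vk3_eq_zero ((P3_le_P1 D).trans hP1n)]; simp

omit χ x in
/-- `coefN D β m = 0` for `m ≥ ⌈2T²⌉` (`g*(y) = 0` for `y ≤ ½`). [cite: Zhang2022LandauSiegel, §6 Lemma 6.1 p.30] -/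
theorem coefN_eq_zero {β : ℂ} {m : ℕ} (hm : ⌈2 * bigT D ^ 2⌉₊ ≤ m) : coefN D β m = 0 := by
  have hT : 0 < bigT D ^ 2 := pow_pos (Real.exp_pos _) 2
  have hm' : 2 * bigT D ^ 2 ≤ m := le_trans (Nat.le_ceil _) (by exact_mod_cast hm)
  have hm0 : (0 : ℝ) < m := lt_of_lt_of_le (by positivity) hm'
  have hle : bigT D ^ 2 / m ≤ 1 / 2 := by
    rw [div_le_iff₀ hm0]; linarith
  rw [coefN, gstar, if_neg (not_lt.mpr hle)]; simp

/-- **`B₁` over `1 ≤ n ≤ ⌊P⌋`**: `(H₁₄ + ι₂H₁₂)(s,ψ) = Σ_{n≤⌊P⌋} coefB1(n)·ψ(n)·n^{−s}` (`𝓛 ≥ 3`).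
[cite: Zhang2022LandauSiegel, §12 (12.1)–(12.2) p.67] -/
theorem B1_eq_sum_Icc (hL : 3 ≤ ell D) (s : ℂ) :
    H14 χ x s + iota2 * H12 χ x s =
      ∑ n ∈ Finset.Icc 1 ⌊bigP D⌋₊, coefB1 χ n * x.ψ (n : ZMod x.p) * (n : ℂ) ^ (-s) := by
  obtain ⟨-, -, -, -, -, hP1, -, -, -⟩ := intLengths_of_three_le hL
  rw [B1_eq_sum χ x s]
  have h1 : ∀ n : ℕ, ((if (n : ℝ) < bigP D ^ (1 / 2 : ℝ) then vk1 D n else 0) + iota2 * vk2 D n) *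
      pc χ x n * (n : ℂ) ^ (-s) = coefB1 χ n * x.ψ (n : ZMod x.p) * (n : ℂ) ^ (-s) := by
    intro n; rw [coefB1, pc]; ring
  simp_rw [h1]
  exact sum_Ico_eq_sum_Icc_of_vanish x (coefB1 χ) hP1 (fun n hn => coefB1_eq_zero χ hn) s

/-- **`H₂` over `1 ≤ n ≤ ⌊P⌋`**: `H₂(s,ψ) = Σ_{n≤⌊P⌋} coefH2(n)·ψ(n)·n^{−s}` (`𝓛 ≥ 3`).
[cite: Zhang2022LandauSiegel, §2 (2.27); §12 (12.2) p.67] -/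
theorem H2_eq_sum_Icc (hL : 3 ≤ ell D) (s : ℂ) :
    H2 χ x s = ∑ n ∈ Finset.Icc 1 ⌊bigP D⌋₊, coefH2 χ n * x.ψ (n : ZMod x.p) * (n : ℂ) ^ (-s) := by
  obtain ⟨-, -, -, -, -, hP1, -, -, -⟩ := intLengths_of_three_le hL
  rw [H2_eq_sum χ x s]
  have h1 : ∀ n : ℕ, (conj iota3 * vk3 D n + conj iota4 * vk2 D n) * pc χ x n * (n : ℂ) ^ (-s) =
      coefH2 χ n * x.ψ (n : ZMod x.p) * (n : ℂ) ^ (-s) := by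
    intro n; rw [coefH2, pc]; ring
  simp_rw [h1]
  exact sum_Ico_eq_sum_Icc_of_vanish x (coefH2 χ) hP1 (fun n hn => coefH2_eq_zero χ hn) s

/-- **`B` over `1 ≤ n ≤ ⌊P⌋`**: `B(s,ψ) = Σ_{n≤⌊P⌋} b(n)χ(n)·ψ(n)·n^{−s}` (`𝓛 ≥ 3`; (15.1)–(15.2)).
[cite: Zhang2022LandauSiegel, §15 (15.1)–(15.2) p.79] -/
theorem Bpoly_eq_sum_Icc (hL : 3 ≤ ell D) (s : ℂ) :
    Bpoly χ x s = ∑ n ∈ Finset.Icc 1 ⌊bigP D⌋₊, coefB χ n * x.ψ (n : ZMod x.p) * (n : ℂ) ^ (-s) := by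
  obtain ⟨-, -, -, -, -, -, hPT, -, -⟩ := intLengths_of_three_le hL
  rw [Bpoly_eq_sum_Ico χ x hL s]
  have h1 : ∀ n : ℕ, bcoef D n * pc χ x n * (n : ℂ) ^ (-s) =
      coefB χ n * x.ψ (n : ZMod x.p) * (n : ℂ) ^ (-s) := by
    intro n; rw [coefB, pc]; ring
  simp_rw [h1]
  refine sum_Ico_eq_sum_Icc_of_vanish x (coefB χ) hPT (fun n hn => ?_) s
  have hn' : bigP D / bigT D ^ 2 ≤ n := by
    have := Nat.lt_floor_add_one (bigP D / bigT D ^ 2)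
    exact le_of_lt (lt_of_lt_of_le this (by exact_mod_cast hn))
  rw [coefB, bcoef_eq_zero_of_le hL hn', zero_mul]

/-- **`N(s+β,ψ)` over `1 ≤ m ≤ ⌊P⌋`**: `= Σ_{m≤⌊P⌋} coefN(β,m)·ψ(m)·m^{−s}` (`𝓛 ≥ 3`).
[cite: Zhang2022LandauSiegel, §6 Lemma 6.1 p.30; §13 (13.3)] -/
theorem Nchar_shift_eq_sum_Icc (hL : 3 ≤ ell D) (s β : ℂ) :
    Nchar D (psiFn x) (s + β) =
      ∑ m ∈ Finset.Icc 1 ⌊bigP D⌋₊, coefN D β m * x.ψ (m : ZMod x.p) * (m : ℂ) ^ (-s) := by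
  obtain ⟨-, -, -, h2T, -, -, -, -, -⟩ := intLengths_of_three_le hL
  rw [Nchar_shift_eq_sum x s β]
  exact sum_Ico_eq_sum_Icc_of_vanish x (coefN D β) h2T (fun m hm => coefN_eq_zero hm) s

/-- **The `E₁`-integrand `D_{T³}(s+w,ψ)` over `1 ≤ n ≤ ⌊P⌋`**: `Σ_{1≤n<⌈T³⌉} ψ(n)n^{−(s+w)} =
Σ_{n≤⌊P⌋} coefD(w,n)·ψ(n)·n^{−s}` (`𝓛 ≥ 3`; `w = β_j + iv` in `E₁(ρ+β_j,ψ)`).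
[cite: Zhang2022LandauSiegel, §6 Lemma 6.1 p.30; §13 (13.3)] -/
theorem dirPolyT3_eq_sum_Icc (hL : 3 ≤ ell D) (s w : ℂ) :
    ∑ n ∈ Finset.Ico 1 ⌈bigT D ^ 3⌉₊, x.ψ (n : ZMod x.p) * (n : ℂ) ^ (-(s + w)) =
      ∑ n ∈ Finset.Icc 1 ⌊bigP D⌋₊, coefD D w n * x.ψ (n : ZMod x.p) * (n : ℂ) ^ (-s) := by
  obtain ⟨-, -, -, -, hT3, -, -, -, -⟩ := intLengths_of_three_le hL
  have h1 : ∑ n ∈ Finset.Ico 1 ⌈bigT D ^ 3⌉₊, x.ψ (n : ZMod x.p) * (n : ℂ) ^ (-(s + w)) =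
      ∑ n ∈ Finset.Ico 1 ⌈bigT D ^ 3⌉₊, coefD D w n * x.ψ (n : ZMod x.p) * (n : ℂ) ^ (-s) := by
    refine Finset.sum_congr rfl fun n hn => ?_
    rw [Finset.mem_Ico] at hn
    have hn0 : (n : ℂ) ≠ 0 := by exact_mod_cast (show n ≠ 0 by omega)
    rw [coefD, if_pos hn.2, neg_add, Complex.cpow_add _ _ hn0]; ring
  rw [h1]
  exact sum_Ico_eq_sum_Icc_of_vanish x (coefD D w) hT3
    (fun n hn => by rw [coefD, if_neg (not_lt.mpr hn)]) s

/-! ### The products `N·B₁`, `N·H₂`, `D_{T³}·B₁`, `D_{T³}·H₂`, `N·N` over `1 ≤ k ≤ ⌊P⌋` -/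

/-- The `Ico 1 ⌈P₁⌉`-forms of `B₁`, `H₂` with the `χ`-absorbed coefficients. [cite: Zhang2022LandauSiegel, §12 (12.2)] -/
theorem B1_H2_eq_sum_Ico (s : ℂ) :
    (H14 χ x s + iota2 * H12 χ x s =
      ∑ n ∈ Finset.Ico 1 ⌈Skeleton.P1 D⌉₊, coefB1 χ n * x.ψ (n : ZMod x.p) * (n : ℂ) ^ (-s)) ∧
    (H2 χ x s = ∑ n ∈ Finset.Ico 1 ⌈Skeleton.P1 D⌉₊, coefH2 χ n * x.ψ (n : ZMod x.p) * (n : ℂ) ^ (-s)) := by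
  constructor
  · rw [B1_eq_sum χ x s]
    refine Finset.sum_congr rfl fun n _ => ?_
    rw [coefB1, pc]; ring
  · rw [H2_eq_sum χ x s]
    refine Finset.sum_congr rfl fun n _ => ?_
    rw [coefH2, pc]; ring

/-- The `Ico 1 ⌈T³⌉`-form of `D_{T³}(s+w,ψ)` with the coefficient `coefD`. [cite: Zhang2022LandauSiegel, §6 Lemma 6.1] -/
theorem dirPolyT3_eq_sum_Ico (s w : ℂ) :
    ∑ n ∈ Finset.Ico 1 ⌈bigT D ^ 3⌉₊, x.ψ (n : ZMod x.p) * (n : ℂ) ^ (-(s + w)) =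
      ∑ n ∈ Finset.Ico 1 ⌈bigT D ^ 3⌉₊, coefD D w n * x.ψ (n : ZMod x.p) * (n : ℂ) ^ (-s) := by
  refine Finset.sum_congr rfl fun n hn => ?_
  rw [Finset.mem_Ico] at hn
  have hn0 : (n : ℂ) ≠ 0 := by exact_mod_cast (show n ≠ 0 by omega)
  rw [coefD, if_pos hn.2, neg_add, Complex.cpow_add _ _ hn0]; ring

/-- **`N(s+β,ψ)·B₁(s,ψ) = Σ_{k≤⌊P⌋} prodCoeff(coefN β, coefB1)(k)·ψ(k)·k^{−s}`** (`𝓛 ≥ 3`).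
[cite: Zhang2022LandauSiegel, §13 (13.3), (13.11) p.75] -/
theorem Nchar_mul_B1_eq_sum_Icc (hL : 3 ≤ ell D) (s β : ℂ) :
    Nchar D (psiFn x) (s + β) * (H14 χ x s + iota2 * H12 χ x s) =
      ∑ k ∈ Finset.Icc 1 ⌊bigP D⌋₊,
        prodCoeff (coefN D β) (coefB1 χ) ⌈2 * bigT D ^ 2⌉₊ ⌈Skeleton.P1 D⌉₊ k *
          x.ψ (k : ZMod x.p) * (k : ℂ) ^ (-s) := by
  obtain ⟨hK, -, -, -, -, -, -, -, -⟩ := intLengths_of_three_le hL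
  rw [Nchar_shift_eq_sum x s β, (B1_H2_eq_sum_Ico χ x s).1]
  exact mul_twisted_eq_sum_Icc_prodCoeff x _ _ hK s

/-- **`N(s+β,ψ)·H₂(s,ψ)`** over `1 ≤ k ≤ ⌊P⌋` (`𝓛 ≥ 3`). [cite: Zhang2022LandauSiegel, §13 (13.3), (13.11) p.75] -/
theorem Nchar_mul_H2_eq_sum_Icc (hL : 3 ≤ ell D) (s β : ℂ) :
    Nchar D (psiFn x) (s + β) * H2 χ x s =
      ∑ k ∈ Finset.Icc 1 ⌊bigP D⌋₊,
        prodCoeff (coefN D β) (coefH2 χ) ⌈2 * bigT D ^ 2⌉₊ ⌈Skeleton.P1 D⌉₊ k *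
          x.ψ (k : ZMod x.p) * (k : ℂ) ^ (-s) := by
  obtain ⟨hK, -, -, -, -, -, -, -, -⟩ := intLengths_of_three_le hL
  rw [Nchar_shift_eq_sum x s β, (B1_H2_eq_sum_Ico χ x s).2]
  exact mul_twisted_eq_sum_Icc_prodCoeff x _ _ hK s

/-- **`D_{T³}(s+w,ψ)·B₁(s,ψ)`** over `1 ≤ k ≤ ⌊P⌋` (`𝓛 ≥ 3`; `w = β_j + iv`, uniform in `v`).
[cite: Zhang2022LandauSiegel, §13 (13.3), (13.11) p.75; §6 Lemma 6.1] -/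
theorem dirPolyT3_mul_B1_eq_sum_Icc (hL : 3 ≤ ell D) (s w : ℂ) :
    (∑ n ∈ Finset.Ico 1 ⌈bigT D ^ 3⌉₊, x.ψ (n : ZMod x.p) * (n : ℂ) ^ (-(s + w))) *
        (H14 χ x s + iota2 * H12 χ x s) =
      ∑ k ∈ Finset.Icc 1 ⌊bigP D⌋₊,
        prodCoeff (coefD D w) (coefB1 χ) ⌈bigT D ^ 3⌉₊ ⌈Skeleton.P1 D⌉₊ k *
          x.ψ (k : ZMod x.p) * (k : ℂ) ^ (-s) := by
  obtain ⟨-, hK, -, -, -, -, -, -, -⟩ := intLengths_of_three_le hL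
  rw [dirPolyT3_eq_sum_Ico x s w, (B1_H2_eq_sum_Ico χ x s).1]
  exact mul_twisted_eq_sum_Icc_prodCoeff x _ _ hK s

/-- **`D_{T³}(s+w,ψ)·H₂(s,ψ)`** over `1 ≤ k ≤ ⌊P⌋` (`𝓛 ≥ 3`). [cite: Zhang2022LandauSiegel, §13 (13.3), (13.11) p.75] -/
theorem dirPolyT3_mul_H2_eq_sum_Icc (hL : 3 ≤ ell D) (s w : ℂ) :
    (∑ n ∈ Finset.Ico 1 ⌈bigT D ^ 3⌉₊, x.ψ (n : ZMod x.p) * (n : ℂ) ^ (-(s + w))) * H2 χ x s =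
      ∑ k ∈ Finset.Icc 1 ⌊bigP D⌋₊,
        prodCoeff (coefD D w) (coefH2 χ) ⌈bigT D ^ 3⌉₊ ⌈Skeleton.P1 D⌉₊ k *
          x.ψ (k : ZMod x.p) * (k : ℂ) ^ (-s) := by
  obtain ⟨-, hK, -, -, -, -, -, -, -⟩ := intLengths_of_three_le hL
  rw [dirPolyT3_eq_sum_Ico x s w, (B1_H2_eq_sum_Ico χ x s).2]
  exact mul_twisted_eq_sum_Icc_prodCoeff x _ _ hK s

omit χ in
/-- **`N(s+β,ψ)·N(s+β′,ψ)`** over `1 ≤ k ≤ ⌊P⌋` (`𝓛 ≥ 3`; the `N₂N₃` of the Lemma-4.8 remainder and of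
the second `E₁*`-line). [cite: Zhang2022LandauSiegel, §13 (13.3), (13.11) p.75] -/
theorem Nchar_mul_Nchar_eq_sum_Icc (hL : 3 ≤ ell D) (s β β' : ℂ) :
    Nchar D (psiFn x) (s + β) * Nchar D (psiFn x) (s + β') =
      ∑ k ∈ Finset.Icc 1 ⌊bigP D⌋₊,
        prodCoeff (coefN D β) (coefN D β') ⌈2 * bigT D ^ 2⌉₊ ⌈2 * bigT D ^ 2⌉₊ k *
          x.ψ (k : ZMod x.p) * (k : ℂ) ^ (-s) := by
  obtain ⟨-, -, hK, -, -, -, -, -, -⟩ := intLengths_of_three_le hL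
  rw [Nchar_shift_eq_sum x s β, Nchar_shift_eq_sum x s β']
  exact mul_twisted_eq_sum_Icc_prodCoeff x _ _ hK s

/-! ### Diagonal bounds and sup bounds for the ten families (explicit exponents) -/

omit x in
/-- **Diagonal bounds, length-`≤ P₁` families** (`𝓛 ≥ 3`): for `c ∈ {coefB1, coefH2}` with constants
`K₁ = 1 + |ι₂|`, `K₂ = |ι₃| + |ι₄|`: `Σ_{n≤⌊P⌋}‖c(n)‖²(n^{−(1+2α)} + n^{−(1−2α)}) ≤ 4e^{8π}·majorantConst(1,2)·K²·𝓛⁹`.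
[cite: Zhang2022LandauSiegel, §13 (13.11) p.75] -/
theorem diag_coefB1_coefH2_le (hL : 3 ≤ ell D) :
    (∑ n ∈ Finset.Icc 1 ⌊bigP D⌋₊,
        ‖coefB1 χ n‖ ^ 2 * ((n : ℝ) ^ (-(1 + 2 * alpha D)) + (n : ℝ) ^ (-(1 - 2 * alpha D))) ≤
      4 * Real.exp (8 * π) * majorantConst 1 2 * (1 + ‖iota2‖) ^ 2 * ell D ^ 9) ∧
    (∑ n ∈ Finset.Icc 1 ⌊bigP D⌋₊,
        ‖coefH2 χ n‖ ^ 2 * ((n : ℝ) ^ (-(1 + 2 * alpha D)) + (n : ℝ) ^ (-(1 - 2 * alpha D))) ≤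
      4 * Real.exp (8 * π) * majorantConst 1 2 * (‖iota3‖ + ‖iota4‖) ^ 2 * ell D ^ 9) := by
  have hD2 : 2 ≤ Real.log D := by have h := hL; rw [ell] at h; linarith
  have h1 := diag_le_of_le_tau hL 1 (fun n hn => ((norm_coefB1_le' χ hD2 n).2 hn))
  have h2 := diag_le_of_le_tau hL 1 (fun n hn => ((norm_coefH2_le' χ hD2 n).2 hn))
  constructor
  · refine h1.trans (le_of_eq ?_); norm_num; ring
  · refine h2.trans (le_of_eq ?_); norm_num; ring

omit x in
/-- **Diagonal bound for `B`** (`𝓛 ≥ 3`): `Σ_{n≤⌊P⌋}‖b(n)χ(n)‖²(n^{−(1+2α)} + n^{−(1−2α)}) ≤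
32e^{8π}·majorantConst(4,4)·((1+|ι₂|)(|ι₃|+|ι₄|))²·𝓛³⁶`. [cite: Zhang2022LandauSiegel, §13 (13.11) p.75; §15 (15.2)] -/
theorem diag_coefB_le (hL : 3 ≤ ell D) :
    ∑ n ∈ Finset.Icc 1 ⌊bigP D⌋₊,
        ‖coefB χ n‖ ^ 2 * ((n : ℝ) ^ (-(1 + 2 * alpha D)) + (n : ℝ) ^ (-(1 - 2 * alpha D))) ≤
      32 * Real.exp (8 * π) * majorantConst 4 4 * ((1 + ‖iota2‖) * (‖iota3‖ + ‖iota4‖)) ^ 2 *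
        ell D ^ 36 := by
  have hD2 : 2 ≤ Real.log D := by have h := hL; rw [ell] at h; linarith
  have h := diag_le_of_le_tau hL 2 (fun n _ => (norm_coefB_le χ hD2 n).1)
  refine h.trans (le_of_eq ?_); norm_num; ring

omit χ x in
/-- **Diagonal bounds for `N(·+β)` and `D_{T³}(·+w)`** (`𝓛 ≥ 3`, `Re β = Re w = 0`): `≤ 4e^{8π}·majorantConst(1,2)·𝓛⁹`.
[cite: Zhang2022LandauSiegel, §13 (13.11) p.75; §6 Lemma 6.1] -/
theorem diag_coefN_coefD_le (hL : 3 ≤ ell D) {β w : ℂ} (hβ : β.re = 0) (hw : w.re = 0) :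
    (∑ n ∈ Finset.Icc 1 ⌊bigP D⌋₊,
        ‖coefN D β n‖ ^ 2 * ((n : ℝ) ^ (-(1 + 2 * alpha D)) + (n : ℝ) ^ (-(1 - 2 * alpha D))) ≤
      4 * Real.exp (8 * π) * majorantConst 1 2 * ell D ^ 9) ∧
    (∑ n ∈ Finset.Icc 1 ⌊bigP D⌋₊,
        ‖coefD D w n‖ ^ 2 * ((n : ℝ) ^ (-(1 + 2 * alpha D)) + (n : ℝ) ^ (-(1 - 2 * alpha D))) ≤
      4 * Real.exp (8 * π) * majorantConst 1 2 * ell D ^ 9) := by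
  have hL0 : 0 < ell D := by linarith
  have h1 := diag_le_of_le_tau hL 1 (fun n hn => (norm_coefN_le hL0 hβ n).2 hn)
  have h2 := diag_le_of_le_tau hL 1 (fun n hn => (norm_coefD_le (D := D) hw n).2 hn)
  constructor
  · refine h1.trans (le_of_eq ?_); norm_num; ring
  · refine h2.trans (le_of_eq ?_); norm_num; ring

omit x in
/-- **Diagonal bounds for the products `N·B₁`, `N·H₂`** (`𝓛 ≥ 3`, `Re β = 0`):
`≤ 32e^{8π}·majorantConst(4,4)·K_i²·𝓛³⁶` (`K₁ = 1+|ι₂|`, `K₂ = |ι₃|+|ι₄|`).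
[cite: Zhang2022LandauSiegel, §13 (13.3), (13.11) p.75] -/
theorem diag_prodN_le (hL : 3 ≤ ell D) {β : ℂ} (hβ : β.re = 0) :
    (∑ k ∈ Finset.Icc 1 ⌊bigP D⌋₊,
        ‖prodCoeff (coefN D β) (coefB1 χ) ⌈2 * bigT D ^ 2⌉₊ ⌈Skeleton.P1 D⌉₊ k‖ ^ 2 *
          ((k : ℝ) ^ (-(1 + 2 * alpha D)) + (k : ℝ) ^ (-(1 - 2 * alpha D))) ≤
      32 * Real.exp (8 * π) * majorantConst 4 4 * (1 + ‖iota2‖) ^ 2 * ell D ^ 36) ∧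
    (∑ k ∈ Finset.Icc 1 ⌊bigP D⌋₊,
        ‖prodCoeff (coefN D β) (coefH2 χ) ⌈2 * bigT D ^ 2⌉₊ ⌈Skeleton.P1 D⌉₊ k‖ ^ 2 *
          ((k : ℝ) ^ (-(1 + 2 * alpha D)) + (k : ℝ) ^ (-(1 - 2 * alpha D))) ≤
      32 * Real.exp (8 * π) * majorantConst 4 4 * (‖iota3‖ + ‖iota4‖) ^ 2 * ell D ^ 36) := by
  have hL0 : 0 < ell D := by linarith
  have hD2 : 2 ≤ Real.log D := by have h := hL; rw [ell] at h; linarith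
  have hF := fun m hm => (norm_coefN_le (D := D) hL0 hβ m).2 hm
  have h1 := diag_le_of_le_tau hL 2 (fun k hk => norm_prodCoeff_le (j₁ := 1) (j₂ := 1) zero_le_one hF
    (fun n hn => (norm_coefB1_le' χ hD2 n).2 hn) ⌈2 * bigT D ^ 2⌉₊ ⌈Skeleton.P1 D⌉₊ hk)
  have h2 := diag_le_of_le_tau hL 2 (fun k hk => norm_prodCoeff_le (j₁ := 1) (j₂ := 1) zero_le_one hF
    (fun n hn => (norm_coefH2_le' χ hD2 n).2 hn) ⌈2 * bigT D ^ 2⌉₊ ⌈Skeleton.P1 D⌉₊ hk)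
  constructor
  · refine h1.trans (le_of_eq ?_); norm_num; ring
  · refine h2.trans (le_of_eq ?_); norm_num; ring

omit x in
/-- **Diagonal bounds for the products `D_{T³}·B₁`, `D_{T³}·H₂`** (`𝓛 ≥ 3`, `Re w = 0`; uniform in the
`v` of `w = β_j + iv`): `≤ 32e^{8π}·majorantConst(4,4)·K_i²·𝓛³⁶`.
[cite: Zhang2022LandauSiegel, §13 (13.3), (13.11) p.75; §6 Lemma 6.1] -/
theorem diag_prodD_le (hL : 3 ≤ ell D) {w : ℂ} (hw : w.re = 0) :
    (∑ k ∈ Finset.Icc 1 ⌊bigP D⌋₊,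
        ‖prodCoeff (coefD D w) (coefB1 χ) ⌈bigT D ^ 3⌉₊ ⌈Skeleton.P1 D⌉₊ k‖ ^ 2 *
          ((k : ℝ) ^ (-(1 + 2 * alpha D)) + (k : ℝ) ^ (-(1 - 2 * alpha D))) ≤
      32 * Real.exp (8 * π) * majorantConst 4 4 * (1 + ‖iota2‖) ^ 2 * ell D ^ 36) ∧
    (∑ k ∈ Finset.Icc 1 ⌊bigP D⌋₊,
        ‖prodCoeff (coefD D w) (coefH2 χ) ⌈bigT D ^ 3⌉₊ ⌈Skeleton.P1 D⌉₊ k‖ ^ 2 *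
          ((k : ℝ) ^ (-(1 + 2 * alpha D)) + (k : ℝ) ^ (-(1 - 2 * alpha D))) ≤
      32 * Real.exp (8 * π) * majorantConst 4 4 * (‖iota3‖ + ‖iota4‖) ^ 2 * ell D ^ 36) := by
  have hD2 : 2 ≤ Real.log D := by have h := hL; rw [ell] at h; linarith
  have hF := fun m hm => (norm_coefD_le (D := D) hw m).2 hm
  have h1 := diag_le_of_le_tau hL 2 (fun k hk => norm_prodCoeff_le (j₁ := 1) (j₂ := 1) zero_le_one hF
    (fun n hn => (norm_coefB1_le' χ hD2 n).2 hn) ⌈bigT D ^ 3⌉₊ ⌈Skeleton.P1 D⌉₊ hk)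
  have h2 := diag_le_of_le_tau hL 2 (fun k hk => norm_prodCoeff_le (j₁ := 1) (j₂ := 1) zero_le_one hF
    (fun n hn => (norm_coefH2_le' χ hD2 n).2 hn) ⌈bigT D ^ 3⌉₊ ⌈Skeleton.P1 D⌉₊ hk)
  constructor
  · refine h1.trans (le_of_eq ?_); norm_num; ring
  · refine h2.trans (le_of_eq ?_); norm_num; ring

omit χ x in
/-- **Diagonal bound for `N(·+β)·N(·+β′)`** (`𝓛 ≥ 3`, `Re β = Re β′ = 0`):
`≤ 32e^{8π}·majorantConst(4,4)·𝓛³⁶`. [cite: Zhang2022LandauSiegel, §13 (13.3), (13.11) p.75] -/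
theorem diag_prodNN_le (hL : 3 ≤ ell D) {β β' : ℂ} (hβ : β.re = 0) (hβ' : β'.re = 0) :
    ∑ k ∈ Finset.Icc 1 ⌊bigP D⌋₊,
        ‖prodCoeff (coefN D β) (coefN D β') ⌈2 * bigT D ^ 2⌉₊ ⌈2 * bigT D ^ 2⌉₊ k‖ ^ 2 *
          ((k : ℝ) ^ (-(1 + 2 * alpha D)) + (k : ℝ) ^ (-(1 - 2 * alpha D))) ≤
      32 * Real.exp (8 * π) * majorantConst 4 4 * ell D ^ 36 := by
  have hL0 : 0 < ell D := by linarith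
  have h := diag_le_of_le_tau hL 2 (fun k hk => norm_prodCoeff_le (j₁ := 1) (j₂ := 1) zero_le_one
    (fun m hm => (norm_coefN_le (D := D) hL0 hβ m).2 hm)
    (fun m hm => (norm_coefN_le (D := D) hL0 hβ' m).2 hm) ⌈2 * bigT D ^ 2⌉₊ ⌈2 * bigT D ^ 2⌉₊ hk)
  refine h.trans (le_of_eq ?_); norm_num; ring

omit x in
/-- **Crude sup bounds** (the `c_max` of the negligible term): the product coefficients are bounded by
`K·P²` (`𝓛 ≥ 3`; `τ₂(k) ≤ k² ≤ P²` on the support `k ≤ P`).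
[cite: Zhang2022LandauSiegel, §13 (13.11) p.75] -/
theorem norm_prodCoeff_families_le (hL : 3 ≤ ell D) {β β' w : ℂ} (hβ : β.re = 0) (hβ' : β'.re = 0)
    (hw : w.re = 0) (k : ℕ) :
    ‖prodCoeff (coefN D β) (coefB1 χ) ⌈2 * bigT D ^ 2⌉₊ ⌈Skeleton.P1 D⌉₊ k‖ ≤ (1 + ‖iota2‖) * bigP D ^ 2 ∧
    ‖prodCoeff (coefN D β) (coefH2 χ) ⌈2 * bigT D ^ 2⌉₊ ⌈Skeleton.P1 D⌉₊ k‖ ≤ (‖iota3‖ + ‖iota4‖) * bigP D ^ 2 ∧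
    ‖prodCoeff (coefD D w) (coefB1 χ) ⌈bigT D ^ 3⌉₊ ⌈Skeleton.P1 D⌉₊ k‖ ≤ (1 + ‖iota2‖) * bigP D ^ 2 ∧
    ‖prodCoeff (coefD D w) (coefH2 χ) ⌈bigT D ^ 3⌉₊ ⌈Skeleton.P1 D⌉₊ k‖ ≤ (‖iota3‖ + ‖iota4‖) * bigP D ^ 2 ∧
    ‖prodCoeff (coefN D β) (coefN D β') ⌈2 * bigT D ^ 2⌉₊ ⌈2 * bigT D ^ 2⌉₊ k‖ ≤ bigP D ^ 2 := by
  have hL0 : 0 < ell D := by linarith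
  have hD2 : 2 ≤ Real.log D := by have h := hL; rw [ell] at h; linarith
  obtain ⟨hK1, hK2, hK3, -, -, -, -, -, -⟩ := intLengths_of_three_le hL
  have hP : 0 < bigP D := Real.exp_pos _
  have hfl : (⌊bigP D⌋₊ : ℝ) ≤ bigP D := Nat.floor_le hP.le
  have hsq : ∀ {m : ℕ}, m ≤ ⌊bigP D⌋₊ → ((m : ℕ) : ℝ) ^ (1 + 1) ≤ bigP D ^ 2 := by
    intro m hm
    have hm' : (m : ℝ) ≤ bigP D := (show (m : ℝ) ≤ ⌊bigP D⌋₊ by exact_mod_cast hm).trans hfl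
    exact pow_le_pow_left₀ (Nat.cast_nonneg _) hm' 2
  have hN := fun m hm => (norm_coefN_le (D := D) hL0 hβ m).2 hm
  have hN' := fun m hm => (norm_coefN_le (D := D) hL0 hβ' m).2 hm
  have hDc := fun m hm => (norm_coefD_le (D := D) hw m).2 hm
  have hB1 := fun n hn => (norm_coefB1_le' χ hD2 n).2 hn
  have hH2 := fun n hn => (norm_coefH2_le' χ hD2 n).2 hn
  have hι2 : 0 ≤ 1 + ‖iota2‖ := by positivity
  have hι34 : 0 ≤ ‖iota3‖ + ‖iota4‖ := by positivity
  refine ⟨?_, ?_, ?_, ?_, ?_⟩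
  · refine (norm_prodCoeff_le_sup zero_le_one hι2 hN hB1 _ _ k).trans ?_
    rw [one_mul]; exact mul_le_mul_of_nonneg_left (hsq hK1) hι2
  · refine (norm_prodCoeff_le_sup zero_le_one hι34 hN hH2 _ _ k).trans ?_
    rw [one_mul]; exact mul_le_mul_of_nonneg_left (hsq hK1) hι34
  · refine (norm_prodCoeff_le_sup zero_le_one hι2 hDc hB1 _ _ k).trans ?_
    rw [one_mul]; exact mul_le_mul_of_nonneg_left (hsq hK2) hι2
  · refine (norm_prodCoeff_le_sup zero_le_one hι34 hDc hH2 _ _ k).trans ?_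
    rw [one_mul]; exact mul_le_mul_of_nonneg_left (hsq hK2) hι34
  · refine (norm_prodCoeff_le_sup zero_le_one zero_le_one hN hN' _ _ k).trans ?_
    rw [one_mul, one_mul]; exact hsq hK3

end Coefficients

end Literature.NumberTheory.LFunctions.Zhang2022.Typed.Section13
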